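import Literature.Barriers.CriticalPhenomena.GaussianDominationRouteNobleAnalysis
import HarnessLib

/-!
# The `β`-map of [NoBLE17, Appendix D] typed over the tree vocabulary (V1(a), stage 2)

CITATION HEADER (PLACEMENT v2). This module is part of a certified REPRODUCTION of:
R. Fitzner, R. van der Hofstad, *Mean-field behavior for nearest-neighbor percolation in d > 10*,
Electron. J. Probab. 22 (2017), no. 43, 1–65 [FvdH17], and *Generalized approach to the non-backtracking
lace expansion*, Probab. Theory Related Fields 169 (2017), 1041–1119 [NoBLE17] (arXiv:1506.07977, 1506.07969).
Reproduces: the per-dimension form of [NoBLE17] Def. 2.9 / Prop. 2.11 / Thm. 2.10 and its assembly with the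
hub tree's NoBLE→infrared→triangle→θ(p_c)=0 chain. Origin: build `lace`, staging package `LaceExpansionHighD`.

GENERATED by `HOME/lean2/tools/betamap.py emit` from ONE table of formula strings that is also
used (`betamap.py validate`) to re-evaluate every `β` of the `d = 11` run from num1's certified
input tables — agreement with num1's independently transcribed values to relative ~1e-15 (floats),
see `HOME/STATUS.md` (lean2, 2026-08-18).  Do not edit by hand; edit the table and re-emit.
Revision 2 (lean2 gen 2, 2026-08-18; DIVERGENCE D31 / GAPS G16): the (D.21) slot `XiDeltaR` now takes the
WEIGHTED constants as printed — two new `Inputs` fields `xiR0Delta`, `xiR1Delta`; the notebook wiring survives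
only as the comparison variant `extraOfInputsAsCoded`; journal pages added to the citation tags (CITED-FACTS CF13).

What this module is.  [NoBLE17] = Fitzner–van der Hofstad, *Generalized approach to the
non-backtracking lace expansion*, PTRF 169 (2017) 1041–1119, arXiv:1506.07969v3, Appendix D (pp. 1110–1117)
derives the constants of the simplified rewrite (Assumption 2.7, pp. 1059–1060 = the tree's `NobleBeta` table,
consumed by `NobleBootstrapAt` / `NobleImprovementInputsAt`) from the model-dependent diagrammatic bounds of
Assumptions 4.2–4.3 (pp. 1085–1088), in five steps with explicit formulas (D.1)–(D.5), (D.13)–(D.14), (D.21), (D.29),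
(D.32).  The authors' notebook `General.nb` (section "Implementation of the bounds … Appendix D")
implements exactly these formulas as the functions `betaMubarOverMu`, `betaCPhiLow/Up`, `betaAfLow/Up`,
`betaap`, `betaPiHat`, `betaPsiHatLower`, `betaRF`, `betaRp`, `betaRpDelta`, `betaRfDelta`,
`betaRfDeltaLower`, and `Percolation.nb` (In[1213]–[1237]) wires the percolation bounds `Bound[…]` of
[FvdH17, §4] into them.  Here:

* `BetaMap.beta…` — the thirteen functions (`betaap` as its two members `betaapI/II`), transcribed
  from `General.nb` with the notebook's parameter names (real parameters; `d` real), each tagged (D.n);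
* `BetaMap.Inputs` — the record of Assumption-4.3-type constants that `Percolation.nb` feeds in
  (field ↔ `Bound[…]` key in the docstrings), i.e. the INTERFACE of V1(a) stage 1 (the [FvdH17, §§4–6]
  bounds in terms of SRW integrals — not typed here);
* `BetaMap.nobleBetaOfInputs d i : NobleBeta` — the tree's eight-field table assembled exactly as
  `Percolation.nb` does (percolation instance factors `(2d−1)/(2d)` included), with ONE deliberate
  deviation: in (D.32) the 24th argument is the EVEN aggregate `β^{even}_{ΔΞ^ι,0}` as printed, where
  `Percolation.nb` passes the odd one a second time (HOME/DIVERGENCE.md D20 — conservative at d = 11: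
  the coded value of `β_Δ` is LARGER by 6.5e-6); `nobleBetaOfInputsAsCoded` reproduces the notebook;
* `BetaMap.extraOfInputs d i : Fin 5 → ℝ` — the other five `β`'s of Assumption 2.7 (`c̲_Φ`, `ᾱ_F`, `β_{R,F}`,
  `β_{ΔR,Φ}`, `β_{|ΔR,F|}`; fields of seat lean1's 13-field table, inputs of `General.nb`'s f₃-improvement bounds
  `BoundH[2|4|5]`), wired as in `Percolation.nb` EXCEPT in (D.21), where the PAPER is followed — next paragraph.

DIVERGENCE D31 (HOME/DIVERGENCE.md; carver gen 3, 2026-08-18 — a NON-conservative notebook slip; this module follows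
the paper).  (D.21) ([NoBLE17] App. D, pp. 1110–1117; TeX l.3870–3873, eq. `detailed-Bound-Rpz`) bounds
`Σ_x ‖x‖₂² |R_{Φ,z}(x)|` by `β^{(0)}_{ΔΞ,R} + β^{(1)}_{ΔΞ,R} + Σ_{N≥2} β^{(N)}_{ΔΞ} + …`, where Assumption 4.3
(pp. 1085–1088; TeX l.2688–2689) declares, for each `N`, an unweighted constant `Σ_x Ξ^{(N)}_{R,z}(x) ≤ β^{(N)}_{Ξ,R}`
AND a weighted one `Σ_x ‖x‖₂² Ξ^{(N)}_{R,z}(x) ≤ β^{(N)}_{ΔΞ,R}`; `General.nb`'s `betaRpDelta` names its 7th slot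
`XiDeltaR` accordingly.  `Percolation.nb` (carver's text rendering `Percolation.txt`, l.1233) passes the UNWEIGHTED
pair `Bound[Xi,R,0,s] + Bound[Xi,R,1,s]` into that slot, although it computes the weighted pair
`Bound[Xi,R,0,Delta,s]` (l.938) and `Bound[Xi,R,1,Delta,s]` (l.993) and displays it.  At `d = 11`, `s = o`:
0.011983 passed vs 0.042344 printed, so `β_{ΔR,Φ}(o)` = 0.030509 as coded vs 0.060870 as printed (CONSTANTS §H)
— an unweighted ℓ¹ bound does not dominate a ‖x‖₂²-weighted one, so the coded value is NOT an admissible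
Assumption-2.7 constant.  Hence: `extraOfInputs` (component 3) is the PRINTED (D.21) over the fields
`xiR0Delta`, `xiR1Delta`; `extraOfInputsAsCoded` reproduces the notebook call (it is what the two-engine
606/606 AGREE rows of the authors' computation evaluate); `betaRpDelta_sub_of_xiDeltaR` /
`extraOfInputs_three_sub_asCoded` record that (D.21) is affine with slope one in `XiDeltaR`, so the two differ
exactly by the swap of the constants.  CONSEQUENCE (GAPS G16): the PUBLISHED `d = 11` constants fail `f₃`
under the printed (D.21) (float `f₃(o)` = 1.169); the bootstrap closes at RE-TUNED constants (variant `d21w`,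
two-engine certification pending, LEMMAS N35); a certificate module (`MeanFieldD11Cert*`) whose tables feed
`NobleImprovementInputsAt 11 …` must be computed with the `d21w` wiring — a certificate of the notebook wiring
certifies the authors' arithmetic, not the hypotheses of [NoBLE17, Prop. 4.5].

Soundness remark (why interval inputs are fine).  Every field of `Inputs` is an UPPER (resp. LOWER,
for `muMin`, `piAlphaLower`, `piOneLower`, `psiZeroLower`) BOUND required by Assumption 4.3, not a
value to be hit, so an outward-rounded certified enclosure of the SRW-integral expression defining it
is again a valid Assumption-4.3 constant; no monotonicity of the `β`-map is needed for instantiation.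

STATUS / HONEST LABEL (REFEREE V1(b)).  This module makes the map (Ass. 4.3 constants) ↦ (Ass. 2.7
table) kernel-definable and auditable; it does NOT prove [NoBLE17, Prop. 4.5] (that the map is sound)
nor [FvdH17, §§4–6] (that the percolation inputs are valid).  A hypothesis
`NobleImprovementInputsAt d … (nobleBetaOfInputs d i) …` therefore remains ANALYTIC, NOT CITABLE,
CONDITIONAL — with its numeral content pushed one level down, to `i : Inputs`.

References: [cite: FitznerVanDerHofstad2016NoBLE, App. D pp. 1110–1117 (D.1)–(D.32), Assumption 2.7 pp. 1059–1060,
Assumptions 4.1–4.4 pp. 1085–1088, Prop. 4.5 p. 1088]; [cite: FitznerVanDerHofstad2017, §4 (percolation instance of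
Assumption 4.2: Ψ ≤ (p/μ_p) Ξ, Π ≤ p Ξ^ι), §2.5 p. 16 (numerical procedure) and the notebook Percolation.nb,
In[1213]–[1237] (output = EJP Fig. 4, p. 17)].
-/

noncomputable section

namespace Literature.Probability.FitznerVanDerHofstad2017
namespace BetaMap

open Literature.Barriers.CriticalPhenomena

/-- `General.nb` `betaMubarOverMu[d, MuOverMu]` — [NoBLE17, App. D (D.1)] — β_μ := β_μ̄ (the Ass. 4.3 bound on μ̄_p/μ_p), passthrough.
[cite: FitznerVanDerHofstad2016NoBLE, App. D (pp. 1110–1117) (D.1)] -/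
def betaMubarOverMu (_d MuOverMu : ℝ) : ℝ :=
  MuOverMu

/-- `General.nb` `betaCPhiLow[d, mu, XiOneminusZeroAtZero, XiIotaAlphaI]` — [NoBLE17, App. D (D.2), lower] — c̲_Φ.
[cite: FitznerVanDerHofstad2016NoBLE, App. D (pp. 1110–1117) (D.2)] -/
def betaCPhiLow (d mu XiOneminusZeroAtZero XiIotaAlphaI : ℝ) : ℝ :=
  1 - XiOneminusZeroAtZero - (2*d*mu)/(1-mu^2)*XiIotaAlphaI

/-- `General.nb` `betaCPhiUp[d, mu, XiZerominusOneAtZero, XiIotaAlphaII]` — [NoBLE17, App. D (D.2), upper] — c̄_Φ.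
[cite: FitznerVanDerHofstad2016NoBLE, App. D (pp. 1110–1117) (D.2)] -/
def betaCPhiUp (d mu XiZerominusOneAtZero XiIotaAlphaII : ℝ) : ℝ :=
  1 + XiZerominusOneAtZero + (2*d*mu^2)/(1-mu^2)*XiIotaAlphaII

/-- `General.nb` `betaAfLow[d, muMIN, mu, PsiOneminusZeroAlphaI, PsiZerominusOneAlphaII, PiSumAlpha]` — [NoBLE17, App. D (D.3), lower] — α̲_F.
[cite: FitznerVanDerHofstad2016NoBLE, App. D (pp. 1110–1117) (D.3)] -/
def betaAfLow (d muMIN mu PsiOneminusZeroAlphaI PsiZerominusOneAlphaII PiSumAlpha : ℝ) : ℝ :=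
  (2*d*muMIN)/(1-muMIN^2)*(1 - PsiOneminusZeroAlphaI - mu*PsiZerominusOneAlphaII - 1/(1-mu^2)*PiSumAlpha)

/-- `General.nb` `betaAfUp[d, mu, PsiZerominusOneAlphaI, PsiOneminusZeroAlphaII, PiSumAlphaLower]` — [NoBLE17, App. D (D.3), upper] — ᾱ_F (not on the ladder path).
[cite: FitznerVanDerHofstad2016NoBLE, App. D (pp. 1110–1117) (D.3)] -/
def betaAfUp (d mu PsiZerominusOneAlphaI PsiOneminusZeroAlphaII PiSumAlphaLower : ℝ) : ℝ :=
  (2*d*mu)/(1-mu^2)*(1 + PsiZerominusOneAlphaI + mu*PsiOneminusZeroAlphaII - 1/(1-mu^2)*PiSumAlphaLower)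

/-- `General.nb` `betaapI[d, mu, XiOneminusZeroAlphaIei, XiIotaAlphaIsumei]` — [NoBLE17, App. D (D.4), first member of the max].
[cite: FitznerVanDerHofstad2016NoBLE, App. D (pp. 1110–1117) (D.4)] -/
def betaapI (d mu XiOneminusZeroAlphaIei XiIotaAlphaIsumei : ℝ) : ℝ :=
  2*d*XiOneminusZeroAlphaIei + (2*d*mu)/(1-mu^2)*XiIotaAlphaIsumei

/-- `General.nb` `betaapII[d, mu, XiZerominusOneAlphaIei, XiIotaAlphaIIsumzero]` — [NoBLE17, App. D (D.4), second member of the max].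
[cite: FitznerVanDerHofstad2016NoBLE, App. D (pp. 1110–1117) (D.4)] -/
def betaapII (d mu XiZerominusOneAlphaIei XiIotaAlphaIIsumzero : ℝ) : ℝ :=
  2*d*XiZerominusOneAlphaIei + (2*d*mu^2)/(1-mu^2)*XiIotaAlphaIIsumzero

/-- `General.nb` `betaPiHat[d, muPiToXiIota, XiIotaEven, PiLower]` — [NoBLE17, App. D (D.5)] — β_Π̂; notebook comment: "be aware of the plus and minus signs of the used constant β_(Ψ)".
[cite: FitznerVanDerHofstad2016NoBLE, App. D (pp. 1110–1117) (D.5)] -/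
def betaPiHat (d muPiToXiIota XiIotaEven PiLower : ℝ) : ℝ :=
  2*d*muPiToXiIota*XiIotaEven - PiLower

/-- `General.nb` `betaPsiHatLower[d, PsiToXi, XiOdd, PsiLower]` — [NoBLE17, App. D (D.5)] — β_Ψ̂ (lower).
[cite: FitznerVanDerHofstad2016NoBLE, App. D (pp. 1110–1117) (D.5)] -/
def betaPsiHatLower (_d PsiToXi XiOdd PsiLower : ℝ) : ℝ :=
  PsiToXi*XiOdd - PsiLower

/-- `General.nb` `betaRF[d, mu, mubar, PsiToXi, muPiToXii, XiAbs, XigeqTwoAbs, XiIotaAbs, XiIotageqOneAbs, PsiRI, PsiRII, PiR]` — [NoBLE17, App. D (D.13)] — β_{R,F}.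
[cite: FitznerVanDerHofstad2016NoBLE, App. D (pp. 1110–1117) (D.13)] -/
def betaRF (d mu mubar PsiToXi muPiToXii XiAbs XigeqTwoAbs XiIotaAbs XiIotageqOneAbs PsiRI PsiRII PiR : ℝ) : ℝ :=
  let tmp1 := (2*d*muPiToXii)/(1-mu)*XiIotaAbs
  let firstLine := (2*d*mu)/(1-mu)*(1+PsiToXi*XiAbs)/(1-tmp1)*tmp1^2
  let secondLine := (2*d)/(1-mu^2)*(mu*PsiRI + mu^2*PsiRII + mubar*(1+mu)*XigeqTwoAbs)
  let thirdLine := (2*d*mu)/((1-mu^2)^2)*(PiR + 2*d*muPiToXii*XiIotageqOneAbs)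
  let fourthLine := ((2*d)^2*mu*muPiToXii)/((1-mu^2)^2)*(2+mu)*XiIotaAbs + ((2*d)^2*muPiToXii*mu)/((1-mu)^2)*XiAbs*XiIotaAbs
  firstLine + secondLine + thirdLine + fourthLine

/-- `General.nb` `betaRp[d, mu, muPsiToXi, muPiToXiIota, XiAbs, XiR, XigeqTwoAbs, XiIotaAbs, XiIotageqOneAbs, XiIotaRI, XiIotaRII]` — [NoBLE17, App. D (D.14)] — β_{R,Φ}.
[cite: FitznerVanDerHofstad2016NoBLE, App. D (pp. 1110–1117) (D.14)] -/
def betaRp (d mu muPsiToXi muPiToXiIota XiAbs XiR XigeqTwoAbs XiIotaAbs XiIotageqOneAbs XiIotaRI XiIotaRII : ℝ) : ℝ :=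
  let tmp1 := (2*d*muPiToXiIota)/(1-mu)*XiIotaAbs
  let partOfXi := XiR + XigeqTwoAbs
  let sumOverPhin := (2*d*mu*XiIotaAbs)/(1-mu)*(1+muPsiToXi*XiAbs)/(1-tmp1)*tmp1
  let lastline := (2*d*mu)/(1-mu)*muPsiToXi*XiAbs*XiIotaAbs + (2*d*mu)/(1-mu^2)*(XiIotaRI + mu*XiIotaRII + (1+mu)*XiIotageqOneAbs)
  partOfXi + sumOverPhin + lastline

/-- `General.nb` `betaRpDelta[d, mu, PsiToXi, muPiToXii, XiAbs, XiDeltaAbs, XiDeltaR, XiDeltageqTwoAbs, XiIotaAbs, XiIotaDeltaEiAbs, XiIotaDeltaZeroAbs, XiIotaDeltaEigeqOneAbs, XiIotaDeltaZerogeqOneAbs, XiIotaDeltaRI, XiIotaDeltaRII]` — [NoBLE17, App. D (D.21)] — β_{ΔR,Φ}.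
[cite: FitznerVanDerHofstad2016NoBLE, App. D (pp. 1110–1117) (D.21)] -/
def betaRpDelta (d mu PsiToXi muPiToXii XiAbs XiDeltaAbs XiDeltaR XiDeltageqTwoAbs XiIotaAbs XiIotaDeltaEiAbs XiIotaDeltaZeroAbs XiIotaDeltaEigeqOneAbs XiIotaDeltaZerogeqOneAbs XiIotaDeltaRI XiIotaDeltaRII : ℝ) : ℝ :=
  let tmp2 := (2*d*muPiToXii)/(1-mu)*XiIotaAbs
  let firstLine := XiDeltaR + XiDeltageqTwoAbs
  let secondLine := (2*d*mu)/(1-mu)*tmp2/(1-tmp2)*PsiToXi*XiDeltaAbs*XiIotaAbs + (2*d)/(1-mu^2)*tmp2*(1/((1-tmp2)^2) + 1/(1-tmp2))*(mu+mu*PsiToXi*XiAbs)/(1+mu)*(XiIotaDeltaEiAbs + mu*XiIotaDeltaZeroAbs)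
  let thirdLine := (2*d*mu*PsiToXi)/(1-mu^2)*((1+mu)*XiDeltaAbs*XiIotaAbs + XiAbs*(XiIotaDeltaEiAbs + mu*XiIotaDeltaZeroAbs))
  let fourthLine := (2*d*mu)/(1-mu^2)*(XiIotaDeltaRI + mu*XiIotaDeltaRII + XiIotaDeltaEigeqOneAbs + mu*XiIotaDeltaZerogeqOneAbs)
  firstLine + secondLine + thirdLine + fourthLine

/-- `General.nb` `betaRfDelta[d, mu, PsiToXi, muPiToXii, XiAbs, XiDeltaAbs, XigeqTwoAbs, XiDeltageqTwoAbs, PsiRDeltaI, PsiRDeltaII, XiIotaAbs, XiIotaDeltaEiAbs, XiIotaDeltaZeroAbs, XiIotageqOneAbs, XiIotaDeltaEigeqOneAbs, betaPiRDelta]` — [NoBLE17, App. D (D.29)] — β_{|ΔR,F|}.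
[cite: FitznerVanDerHofstad2016NoBLE, App. D (pp. 1110–1117) (D.29)] -/
def betaRfDelta (d mu PsiToXi muPiToXii XiAbs XiDeltaAbs XigeqTwoAbs XiDeltageqTwoAbs PsiRDeltaI PsiRDeltaII XiIotaAbs XiIotaDeltaEiAbs XiIotaDeltaZeroAbs XiIotageqOneAbs XiIotaDeltaEigeqOneAbs betaPiRDelta : ℝ) : ℝ :=
  let tmp2 := (2*d*muPiToXii)/(1-mu)*XiIotaAbs
  let l1 := (2*d*mu)/(1-mu)*PsiToXi*XiDeltaAbs*(tmp2^2)/(1-tmp2)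
  let l2 := ((2*d)^2*mu*muPiToXii)/((1-mu^2)*(1-mu))*tmp2/((1-tmp2)^2)*(1+PsiToXi*XiAbs)*(XiIotaDeltaEiAbs + mu*XiIotaDeltaZeroAbs)
  let l3 := ((2*d)^2*mu*muPiToXii)/((1-mu^2)*(1-mu))*tmp2/(1-tmp2)*(1+PsiToXi*XiAbs)*(XiIotaDeltaEiAbs + mu*XiIotaDeltaZeroAbs + XiIotaAbs)
  let l4 := (2*d*mu)/(1-mu^2)*(PsiRDeltaI + mu*PsiRDeltaII + (1+mu)*PsiToXi*XiDeltageqTwoAbs + PsiToXi*XigeqTwoAbs)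
  let l5 := mu/((1-mu^2)^2)*(betaPiRDelta + (2*d)^2*muPiToXii*(XiIotaDeltaEigeqOneAbs + XiIotageqOneAbs))
  let l6 := ((2*d)^2*muPiToXii*mu^2)/((1-mu^2)^2)*(XiIotaDeltaEiAbs + (1+mu)*XiIotaDeltaZeroAbs + XiIotaAbs)
  let l7 := ((2*d)^2*muPiToXii*mu*PsiToXi)/((1-mu)^2)*XiDeltaAbs*XiIotaAbs + ((2*d)^2*muPiToXii*mu*PsiToXi)/((1-mu^2)*(1-mu))*XiAbs*(XiIotaDeltaEiAbs + mu*XiIotaDeltaZeroAbs + XiIotaAbs)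
  l1 + l2 + l3 + l4 + l5 + l6 + l7

/-- `General.nb` `betaRfDeltaLower[d, mu, PsiToXi, muPiToXii, XiAbs, XiOddAbs, XiEvenAbs, XiDeltaAbs, XiDeltaOddAbs, XiDeltaEvenAbs, XigeqTwoOddAbs, XiDeltageqTwoOddAbs, XiDeltageqTwoEven, PsiROneDeltaI, PsiRZeroDeltaII, XiIotaAbs, XiIotaOddAbs, XiIotaEvenAbs, XiIotaDeltaEi, XiIotaDeltaEiOdd, XiIotaDeltaEiEven, XiIotaDeltaZero, XiIotaDeltaZeroOdd, XiIotaDeltaZeroEven, XiIotageqOneEven, XiIotaDeltageqOneEven, betaPiRDelta]` — [NoBLE17, App. D (D.32)] — β̲_{ΔR,F} (a NEGATIVE number; the tree field is `βΔ := −β̲_{ΔR,F}`).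
[cite: FitznerVanDerHofstad2016NoBLE, App. D (pp. 1110–1117) (D.32)] -/
def betaRfDeltaLower (d mu PsiToXi muPiToXii XiAbs XiOddAbs XiEvenAbs XiDeltaAbs XiDeltaOddAbs XiDeltaEvenAbs XigeqTwoOddAbs XiDeltageqTwoOddAbs XiDeltageqTwoEven PsiROneDeltaI PsiRZeroDeltaII XiIotaAbs XiIotaOddAbs XiIotaEvenAbs XiIotaDeltaEi XiIotaDeltaEiOdd XiIotaDeltaEiEven XiIotaDeltaZero XiIotaDeltaZeroOdd XiIotaDeltaZeroEven XiIotageqOneEven XiIotaDeltageqOneEven betaPiRDelta : ℝ) : ℝ :=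
  let tmp2 := (2*d*muPiToXii)/(1-mu)*XiIotaAbs
  let l1 := -((2*d*mu)/(1-mu)*PsiToXi*XiDeltaAbs*(tmp2^2)/(1-tmp2))
  let l2 := -(((2*d)^2*mu*muPiToXii)/((1-mu^2)*(1-mu))*tmp2/((1-tmp2)^2)*(1+PsiToXi*XiAbs)*(XiIotaDeltaEi + mu*XiIotaDeltaZero))
  let l3 := -(((2*d)^2*mu*muPiToXii)/((1-mu^2)*(1-mu))*tmp2/(1-tmp2)*(1+PsiToXi*XiAbs)*(XiIotaDeltaEi + mu*XiIotaDeltaZero + XiIotaAbs))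
  let l4 := -((2*d*mu)/(1-mu^2)*(PsiROneDeltaI + mu*PsiRZeroDeltaII + PsiToXi*(XiDeltageqTwoOddAbs + XigeqTwoOddAbs + mu*XiDeltageqTwoEven)))
  let l5 := -(mu/((1-mu^2)^2)*(betaPiRDelta + (2*d)^2*muPiToXii*(XiIotaDeltageqOneEven + XiIotageqOneEven)))
  let l6 := -(((2*d)^2*muPiToXii*mu^2)/((1-mu^2)^2)*(XiIotaDeltaEiOdd + XiIotaDeltaZeroOdd + XiIotaOddAbs + mu*XiIotaDeltaZeroEven))
  let l7 := -(((2*d)^2*muPiToXii*mu)/((1-mu^2)^2)*(XiDeltaOddAbs*XiIotaOddAbs*(1+mu^2) + 2*mu*XiDeltaEvenAbs*XiIotaEvenAbs))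
  let l8 := -(((2*d)^2*muPiToXii*mu)/((1-mu^2)^2)*XiOddAbs*(XiIotaDeltaEiOdd + XiIotaOddAbs + mu*XiIotaDeltaZeroEven + mu*XiIotaEvenAbs + mu*XiIotaDeltaEiEven + mu^2*XiIotaDeltaZeroOdd))
  let l9 := -(((2*d)^2*muPiToXii*mu)/((1-mu^2)*(1-mu))*XiEvenAbs*(XiIotaDeltaEiEven + XiIotaEvenAbs + mu*XiIotaDeltaZeroOdd + mu*XiIotaOddAbs + mu*XiIotaDeltaEiOdd + mu^2*XiIotaDeltaZeroEven))
  l1 + l2 + l3 + l4 + l5 + l6 + l7 + l8 + l9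

/-- The Assumption-4.3-type input constants fed by `Percolation.nb` into the `β`-functions (one field per
`Bound[…]` used in In[1218]–[1237]; docstring = the [NoBLE17] symbol / the `Bound` key).  All fields are
upper bounds except `muMin`, `piAlphaLower`, `piOneLower`, `psiZeroLower` (lower bounds).
[cite: FitznerVanDerHofstad2016NoBLE, Assumption 4.3 ((4.4)–(4.10)) pp. 1085–1088 and App. D pp. 1110–1117] -/
structure Inputs where
  /-- upper bound used for μ_p: Γ₁/((2d−1)c_μ) (Percolation.nb `mu[s]`; [NoBLE17] App. D bounds μ_p this way) -/
  mu : ℝ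
  /-- LOWER bound β̲_μ on μ_p (`mumin[s]` = z_i(1 − max_s G_3)), Ass. 4.3 (4.4) -/
  muMin : ℝ
  /-- β_μ̄ ≥ μ̄_p/μ_p (`mubOverMu[s]`), Ass. 4.3 (4.4) -/
  mubOverMu : ℝ
  /-- upper bound on μ̄_p (= p for percolation; `mub[s]` = z[s]) -/
  mub : ℝ
  /-- β^{(1−0)}_{Ξ_α(0)} `Bound[Xi,alpha,OneMinusZero,AtZero,s]` -/
  xiAlphaOneMinusZeroAtZero : ℝ
  /-- β^{(0−1)}_{Ξ_α(0)} `Bound[Xi,alpha,ZeroMinusOne,AtZero,s]` -/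
  xiAlphaZeroMinusOneAtZero : ℝ
  /-- β^{(1−0)}_{Ξ_α(e₁)} `Bound[Xi,alpha,OneMinusZero,AtEi,s]` -/
  xiAlphaOneMinusZeroAtEi : ℝ
  /-- β^{(0−1)}_{Ξ_α(e₁)} `Bound[Xi,alpha,ZeroMinusOne,AtEi,s]` -/
  xiAlphaZeroMinusOneAtEi : ℝ
  /-- β^{(0)}_{Ξ^ι_α,I} at e_ι `Bound[XiIota,alphaI,0,Atei,s]` -/
  xiIotaAlphaIAtEi : ℝ
  /-- β^{(0)}_{Ξ^ι_α,II} at 0 `Bound[XiIota,alphaII,0,AtZero,s]` -/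
  xiIotaAlphaIIAtZero : ℝ
  /-- β^{(0)}_{ΣΞ^ι_α,I} `Bound[XiIota,alphaI,0,SumAroundei,s]` -/
  xiIotaAlphaISumAroundEi : ℝ
  /-- β^{(0)}_{ΣΞ^ι_α,II} `Bound[XiIota,alphaII,0,SumAroundZero,s]` -/
  xiIotaAlphaIISumAroundZero : ℝ
  /-- β^{(1−0)}_{ΣΨ_α,I} `Bound[Psi,alphaI,OneMinusZero,AroundEi,s]` -/
  psiAlphaIOneMinusZeroAroundEi : ℝ
  /-- β^{(0−1)}_{ΣΨ_α,II} `Bound[Psi,alphaII,ZeroMinusOne,AroundZero,s]` -/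
  psiAlphaIIZeroMinusOneAroundZero : ℝ
  /-- β^{(0−1)}_{ΣΨ_α,I} (ᾱ_F only) `Bound[Psi,alphaI,ZeroMinusOne,AroundEi,s]` -/
  psiAlphaIZeroMinusOneAroundEi : ℝ
  /-- β^{(1−0)}_{ΣΨ_α,II} (ᾱ_F only) `Bound[Psi,alphaII,OneMinusZero,AroundZero,s]` -/
  psiAlphaIIOneMinusZeroAroundZero : ℝ
  /-- β̄^{(0)}_{ΣΠ_α} `Bound[Pi,alpha,0,s]` -/
  piAlpha : ℝ
  /-- LOWER bound β̲^{(0)}_{ΣΠ_α} (ᾱ_F only) `Bound[Pi,alpha,lower,0,s]` -/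
  piAlphaLower : ℝ
  /-- LOWER bound β̲^{(1)}_{Π̂} entering β_Π̂ (D.5) `Bound[Pi,1,Lower,s]` -/
  piOneLower : ℝ
  /-- LOWER bound β̲^{(0)}_{Ψ̂} entering β_Ψ̂ (D.5) `Bound[Psi,lower,0,s]` -/
  psiZeroLower : ℝ
  /-- Σ_N β^{(N)}_Ξ `Bound[Xi,Absolut,s]` -/
  xiAbs : ℝ
  /-- Σ_{N odd} β^{(N)}_Ξ `Bound[Xi,Odd,s]` -/
  xiOdd : ℝ
  /-- Σ_{N even} β^{(N)}_Ξ `Bound[Xi,Even,s]` -/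
  xiEven : ℝ
  /-- Σ_{N even, N ≥ 2} β^{(N)}_Ξ `Bound[Xi,EvenTail,s]` -/
  xiEvenTail : ℝ
  /-- Σ_{N odd, N ≥ 3} β^{(N)}_Ξ `Bound[Xi,OddTail,s]` -/
  xiOddTail : ℝ
  /-- β^{(0)}_{Ξ,R} (unweighted; enters (D.14)) `Bound[Xi,R,0,s]` -/
  xiR0 : ℝ
  /-- β^{(1)}_{Ξ,R} (unweighted; enters (D.14)) `Bound[Xi,R,1,s]` -/
  xiR1 : ℝ
  /-- β^{(0)}_{ΔΞ,R} (‖x‖₂²-WEIGHTED, Ass. 4.3 second constant; enters (D.21) as printed — DIVERGENCE D31: Percolation.nb computes it (l.938) but passes the unweighted one) `Bound[Xi,R,0,Delta,s]` -/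
  xiR0Delta : ℝ
  /-- β^{(1)}_{ΔΞ,R} (‖x‖₂²-WEIGHTED; enters (D.21) as printed — D31; Percolation.nb l.993) `Bound[Xi,R,1,Delta,s]` -/
  xiR1Delta : ℝ
  /-- Σ_N β^{(N)}_{ΔΞ} `Bound[Xi,Absolut,Delta,s]` -/
  xiDeltaAbs : ℝ
  /-- Σ_{N odd} β^{(N)}_{ΔΞ} `Bound[Xi,Odd,Delta,s]` -/
  xiOddDelta : ℝ
  /-- Σ_{N even} β^{(N)}_{ΔΞ} `Bound[Xi,Even,Delta,s]` -/
  xiEvenDelta : ℝ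
  /-- `Bound[Xi,OddTail,Delta,s]` -/
  xiOddTailDelta : ℝ
  /-- `Bound[Xi,EvenTail,Delta,s]` -/
  xiEvenTailDelta : ℝ
  /-- β^{(0)}_{Ψ,R,I} `Bound[Psi,RI,0,s]` -/
  psiRI0 : ℝ
  /-- β^{(1)}_{Ψ,R,I} `Bound[Psi,RI,1,s]` -/
  psiRI1 : ℝ
  /-- β^{(0)}_{Ψ,R,II} `Bound[Psi,RII,0,s]` -/
  psiRII0 : ℝ
  /-- β^{(1)}_{Ψ,R,II} `Bound[Psi,RII,1,s]` -/
  psiRII1 : ℝ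
  /-- `Bound[Psi,RI,0,Delta,s]` -/
  psiRI0Delta : ℝ
  /-- `Bound[Psi,RI,1,Delta,s]` -/
  psiRI1Delta : ℝ
  /-- `Bound[Psi,RII,0,Delta,s]` -/
  psiRII0Delta : ℝ
  /-- `Bound[Psi,RII,1,Delta,s]` -/
  psiRII1Delta : ℝ
  /-- β^{(0)}_{Π,R} `Bound[Pi,R,0,s]` -/
  piR0 : ℝ
  /-- β_{ΔΠ,R} `Bound[Pi,R,0,Delta,eiek,s]` -/
  piR0DeltaEiEk : ℝ
  /-- Σ_N β^{(N)}_{Ξ^ι} `Bound[XiIota,Absolut,s]` -/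
  xiIotaAbs : ℝ
  /-- Σ_{N odd} β^{(N)}_{Ξ^ι} `Bound[XiIota,Odd,s]` -/
  xiIotaOdd : ℝ
  /-- Σ_{N even} β^{(N)}_{Ξ^ι} `Bound[XiIota,Even,s]` -/
  xiIotaEven : ℝ
  /-- Σ_{N even, N ≥ 2} β^{(N)}_{Ξ^ι} `Bound[XiIota,EvenTail,s]` -/
  xiIotaEvenTail : ℝ
  /-- β^{(0)}_{Ξ^ι,R,I} `Bound[XiIota,RI,0,s]` -/
  xiIotaRI0 : ℝ
  /-- β^{(0)}_{Ξ^ι,R,II} `Bound[XiIota,RII,0,s]` -/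
  xiIotaRII0 : ℝ
  /-- Σ_N β^{(N)}_{ΔΞ^ι,e} `Bound[XiIota,Absolut,Delta,ei,s]` -/
  xiIotaDeltaEi : ℝ
  /-- `Bound[XiIota,Odd,Delta,ei,s]` -/
  xiIotaOddDeltaEi : ℝ
  /-- `Bound[XiIota,Even,Delta,ei,s]` -/
  xiIotaEvenDeltaEi : ℝ
  /-- `Bound[XiIota,EvenTail,Delta,ei,s]` -/
  xiIotaEvenTailDeltaEi : ℝ
  /-- Σ_N β^{(N)}_{ΔΞ^ι,0} `Bound[XiIota,Absolut,Delta,0,s]` -/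
  xiIotaDeltaZero : ℝ
  /-- `Bound[XiIota,Odd,Delta,0,s]` -/
  xiIotaOddDeltaZero : ℝ
  /-- `Bound[XiIota,Even,Delta,0,s]` -/
  xiIotaEvenDeltaZero : ℝ
  /-- `Bound[XiIota,EvenTail,Delta,0,s]` -/
  xiIotaEvenTailDeltaZero : ℝ
  /-- `Bound[XiIota,RI,0,Delta,ei,s]` -/
  xiIotaRI0DeltaEi : ℝ
  /-- `Bound[XiIota,RII,0,Delta,0,s]` -/
  xiIotaRII0DeltaZero : ℝ

/-- The tree's `NobleBeta` table assembled from `i : Inputs` exactly as `Percolation.nb` In[1218]–[1237] wires the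
bounds into `General.nb`'s functions (percolation factors `(2d−1)/(2d)` on `mub`, `mubOverMu` in (D.5), (D.13), (D.14)),
with the 24th argument of (D.32) the EVEN aggregate as printed (the notebook passes the odd one twice: DIVERGENCE D20;
`nobleBetaOfInputsAsCoded` is the notebook's version).
`βΔ := −β̲_{ΔR,F}` (the tree records the magnitude of the negative lower bound (D.32)); `βαΦ := max` of the two members of (D.4).
[cite: FitznerVanDerHofstad2016NoBLE, App. D pp. 1110–1117; FitznerVanDerHofstad2017, §2.5 p. 16 and notebook Percolation.nb In[1218]–[1237]] -/
def nobleBetaOfInputs (d : ℝ) (i : Inputs) : NobleBeta where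
  βμ := betaMubarOverMu d i.mubOverMu
  βPi := betaPiHat d ((2*d-1)/(2*d)*i.mub) (i.xiIotaEven) (i.piOneLower)
  βΨ := betaPsiHatLower d ((2*d-1)/(2*d)*i.mubOverMu) (i.xiOdd) (i.psiZeroLower)
  cΦup := betaCPhiUp d (i.mu) (i.xiAlphaZeroMinusOneAtZero) (i.xiIotaAlphaIIAtZero)
  βαΦ := max (betaapI d (i.mu) (i.xiAlphaOneMinusZeroAtEi) (i.xiIotaAlphaISumAroundEi)) (betaapII d (i.mu) (i.xiAlphaZeroMinusOneAtEi) (i.xiIotaAlphaIISumAroundZero))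
  βRΦ := betaRp d (i.mu) ((2*d-1)/(2*d)*i.mubOverMu) ((2*d-1)/(2*d)*i.mub) (i.xiAbs) (i.xiR0 + i.xiR1) (i.xiEvenTail + i.xiOddTail) (i.xiIotaAbs) (i.xiIotaOdd + i.xiIotaEvenTail) (i.xiIotaRI0) (i.xiIotaRII0)
  αFlow := betaAfLow d (i.muMin) (i.mu) (i.psiAlphaIOneMinusZeroAroundEi) (i.psiAlphaIIZeroMinusOneAroundZero) (i.piAlpha)
  βΔ := -(betaRfDeltaLower d (i.mu) (i.mubOverMu) (i.mub) (i.xiAbs) (i.xiOdd) (i.xiEven) (i.xiDeltaAbs) (i.xiOddDelta) (i.xiEvenDelta) (i.xiOddTail) (i.xiOddTailDelta) (i.xiEvenTailDelta) (i.psiRI1Delta) (i.psiRII0Delta) (i.xiIotaAbs) (i.xiIotaOdd) (i.xiIotaEven) (i.xiIotaDeltaEi) (i.xiIotaOddDeltaEi) (i.xiIotaEvenDeltaEi) (i.xiIotaDeltaZero) (i.xiIotaOddDeltaZero) (i.xiIotaEvenDeltaZero) (i.xiIotaEvenTail) (i.xiIotaEvenTailDeltaEi) (i.piR0DeltaEi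Ek))

/-- The tree's `NobleBeta` table assembled from `i : Inputs` exactly as `Percolation.nb` In[1218]–[1237] wires the
bounds into `General.nb`'s functions (percolation factors `(2d−1)/(2d)` on `mub`, `mubOverMu` in (D.5), (D.13), (D.14)),
REPRODUCING the notebook's duplicated odd aggregate in the 24th argument of (D.32) (DIVERGENCE D20).
`βΔ := −β̲_{ΔR,F}` (the tree records the magnitude of the negative lower bound (D.32)); `βαΦ := max` of the two members of (D.4).
[cite: FitznerVanDerHofstad2016NoBLE, App. D pp. 1110–1117; FitznerVanDerHofstad2017, §2.5 p. 16 and notebook Percolation.nb In[1218]–[1237]] -/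
def nobleBetaOfInputsAsCoded (d : ℝ) (i : Inputs) : NobleBeta where
  βμ := betaMubarOverMu d i.mubOverMu
  βPi := betaPiHat d ((2*d-1)/(2*d)*i.mub) (i.xiIotaEven) (i.piOneLower)
  βΨ := betaPsiHatLower d ((2*d-1)/(2*d)*i.mubOverMu) (i.xiOdd) (i.psiZeroLower)
  cΦup := betaCPhiUp d (i.mu) (i.xiAlphaZeroMinusOneAtZero) (i.xiIotaAlphaIIAtZero)
  βαΦ := max (betaapI d (i.mu) (i.xiAlphaOneMinusZeroAtEi) (i.xiIotaAlphaISumAroundEi)) (betaapII d (i.mu) (i.xiAlphaZeroMinusOneAtEi) (i.xiIotaAlphaIISumAroundZero))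
  βRΦ := betaRp d (i.mu) ((2*d-1)/(2*d)*i.mubOverMu) ((2*d-1)/(2*d)*i.mub) (i.xiAbs) (i.xiR0 + i.xiR1) (i.xiEvenTail + i.xiOddTail) (i.xiIotaAbs) (i.xiIotaOdd + i.xiIotaEvenTail) (i.xiIotaRI0) (i.xiIotaRII0)
  αFlow := betaAfLow d (i.muMin) (i.mu) (i.psiAlphaIOneMinusZeroAroundEi) (i.psiAlphaIIZeroMinusOneAroundZero) (i.piAlpha)
  βΔ := -(betaRfDeltaLower d (i.mu) (i.mubOverMu) (i.mub) (i.xiAbs) (i.xiOdd) (i.xiEven) (i.xiDeltaAbs) (i.xiOddDelta) (i.xiEvenDelta) (i.xiOddTail) (i.xiOddTailDelta) (i.xiEvenTailDelta) (i.psiRI1Delta) (i.psiRII0Delta) (i.xiIotaAbs) (i.xiIotaOdd) (i.xiIotaEven) (i.xiIotaDeltaEi) (i.xiIotaOddDeltaEi) (i.xiIotaEvenDeltaEi) (i.xiIotaDeltaZero) (i.xiIotaOddDeltaZero) (i.xiIotaOddDeltaZero) (i.xiIotaEvenTail) (i.xiIotaEvenTailDeltaEi) (i.piR0DeltaEiE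k))

/-- Sanity: the D20 deviation touches only `βΔ` — the other seven fields agree definitionally. [folklore] -/
theorem nobleBetaOfInputsAsCoded_agrees (d : ℝ) (i : Inputs) :
    (nobleBetaOfInputsAsCoded d i).βμ = (nobleBetaOfInputs d i).βμ ∧
    (nobleBetaOfInputsAsCoded d i).βPi = (nobleBetaOfInputs d i).βPi ∧
    (nobleBetaOfInputsAsCoded d i).βΨ = (nobleBetaOfInputs d i).βΨ ∧
    (nobleBetaOfInputsAsCoded d i).cΦup = (nobleBetaOfInputs d i).cΦup ∧
    (nobleBetaOfInputsAsCoded d i).βαΦ = (nobleBetaOfInputs d i).βαΦ ∧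
    (nobleBetaOfInputsAsCoded d i).βRΦ = (nobleBetaOfInputs d i).βRΦ ∧
    (nobleBetaOfInputsAsCoded d i).αFlow = (nobleBetaOfInputs d i).αFlow :=
  ⟨rfl, rfl, rfl, rfl, rfl, rfl, rfl⟩

/-- The remaining five `β`'s of `General.nb` (not fields of the tree's eight-field `NobleBeta`, but of seat lean1's
13-field table): `c̲_Φ`, `ᾱ_F`, `β_{R,F}`, `β_{ΔR,Φ}`, `β_{|ΔR,F|}`, wired as in `Percolation.nb` EXCEPT component 3:
(D.21) takes the WEIGHTED `β^{(0)}_{ΔΞ,R} + β^{(1)}_{ΔΞ,R}` (`i.xiR0Delta + i.xiR1Delta`) AS PRINTED — the notebook passes the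
unweighted pair (DIVERGENCE D31, non-conservative; `extraOfInputsAsCoded` is the notebook's version).
[cite: FitznerVanDerHofstad2016NoBLE, App. D (pp. 1110–1117) (D.2), (D.3), (D.13), (D.21), (D.29); Assumption 4.3 pp. 1085–1088] -/
def extraOfInputs (d : ℝ) (i : Inputs) : Fin 5 → ℝ :=
  ![betaCPhiLow d (i.mu) (i.xiAlphaOneMinusZeroAtZero) (i.xiIotaAlphaIAtEi),
    betaAfUp d (i.mu) (i.psiAlphaIZeroMinusOneAroundEi) (i.psiAlphaIIOneMinusZeroAroundZero) (i.piAlphaLower),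
    betaRF d (i.mu) (i.mub) ((2*d-1)/(2*d)*i.mubOverMu) ((2*d-1)/(2*d)*i.mub) (i.xiAbs) (i.xiEvenTail + i.xiOddTail) (i.xiIotaAbs) (i.xiIotaOdd + i.xiIotaEvenTail) (i.psiRI0 + i.psiRI1) (i.psiRII0 + i.psiRII1) (i.piR0),
    betaRpDelta d (i.mu) (i.mubOverMu) (i.mub) (i.xiAbs) (i.xiDeltaAbs) (i.xiR0Delta + i.xiR1Delta) (i.xiOddTailDelta + i.xiEvenTailDelta) (i.xiIotaAbs) (i.xiIotaDeltaEi) (i.xiIotaDeltaZero) (i.xiIotaOddDeltaEi + i.xiIotaEvenTailDeltaEi) (i.xiIotaOddDeltaZero + i.xiIotaEvenTailDeltaZero) (i.xiIotaRI0DeltaEi) (i.xiIotaRII0DeltaZero),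
    betaRfDelta d (i.mu) (i.mubOverMu) (i.mub) (i.xiAbs) (i.xiDeltaAbs) (i.xiEvenTail + i.xiOddTail) (i.xiOddTailDelta + i.xiEvenTailDelta) (i.psiRI0Delta + i.psiRI1Delta) (i.psiRII0Delta + i.psiRII1Delta) (i.xiIotaAbs) (i.xiIotaDeltaEi) (i.xiIotaDeltaZero) (i.xiIotaOdd + i.xiIotaEvenTail) (i.xiIotaOddDeltaEi + i.xiIotaEvenTailDeltaEi) (i.piR0DeltaEiEk)]

/-- The same five `β`'s wired VERBATIM as `Percolation.nb` In[1218]–[1237], INCLUDING the DIVERGENCE-D31 slip: the (D.21)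
slot `XiDeltaR` receives the UNWEIGHTED `i.xiR0 + i.xiR1`.  COMPARISON VARIANT ONLY — it is what the two-engine reproduction
of the authors' computation evaluates; its component 3 is NOT an admissible Assumption-2.7 constant `β_{ΔR,Φ}`.
[cite: FitznerVanDerHofstad2016NoBLE, App. D (pp. 1110–1117) (D.21); FitznerVanDerHofstad2017, notebook Percolation.nb In[1233]] -/
def extraOfInputsAsCoded (d : ℝ) (i : Inputs) : Fin 5 → ℝ :=
  ![betaCPhiLow d (i.mu) (i.xiAlphaOneMinusZeroAtZero) (i.xiIotaAlphaIAtEi),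
    betaAfUp d (i.mu) (i.psiAlphaIZeroMinusOneAroundEi) (i.psiAlphaIIOneMinusZeroAroundZero) (i.piAlphaLower),
    betaRF d (i.mu) (i.mub) ((2*d-1)/(2*d)*i.mubOverMu) ((2*d-1)/(2*d)*i.mub) (i.xiAbs) (i.xiEvenTail + i.xiOddTail) (i.xiIotaAbs) (i.xiIotaOdd + i.xiIotaEvenTail) (i.psiRI0 + i.psiRI1) (i.psiRII0 + i.psiRII1) (i.piR0),
    betaRpDelta d (i.mu) (i.mubOverMu) (i.mub) (i.xiAbs) (i.xiDeltaAbs) (i.xiR0 + i.xiR1) (i.xiOddTailDelta + i.xiEvenTailDelta) (i.xiIotaAbs) (i.xiIotaDeltaEi) (i.xiIotaDeltaZero) (i.xiIotaOddDeltaEi + i.xiIotaEvenTailDeltaEi) (i.xiIotaOddDeltaZero + i.xiIotaEvenTailDeltaZero) (i.xiIotaRI0DeltaEi) (i.xiIotaRII0DeltaZero),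
    betaRfDelta d (i.mu) (i.mubOverMu) (i.mub) (i.xiAbs) (i.xiDeltaAbs) (i.xiEvenTail + i.xiOddTail) (i.xiOddTailDelta + i.xiEvenTailDelta) (i.psiRI0Delta + i.psiRI1Delta) (i.psiRII0Delta + i.psiRII1Delta) (i.xiIotaAbs) (i.xiIotaDeltaEi) (i.xiIotaDeltaZero) (i.xiIotaOdd + i.xiIotaEvenTail) (i.xiIotaOddDeltaEi + i.xiIotaEvenTailDeltaEi) (i.piR0DeltaEiEk)]

/-- (D.21) is AFFINE WITH SLOPE ONE in its slot `XiDeltaR` (its first line is `XiDeltaR + XiDeltageqTwoAbs`; no other line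
involves `XiDeltaR`): the DIVERGENCE-D31 correction of `β_{ΔR,Φ}` is additive and equals the swap of the constants.
[cite: FitznerVanDerHofstad2016NoBLE, App. D (pp. 1110–1117) (D.21)] -/
theorem betaRpDelta_sub_of_xiDeltaR (d mu PsiToXi muPiToXii XiAbs XiDeltaAbs XiDeltageqTwoAbs XiIotaAbs XiIotaDeltaEiAbs XiIotaDeltaZeroAbs XiIotaDeltaEigeqOneAbs XiIotaDeltaZerogeqOneAbs XiIotaDeltaRI XiIotaDeltaRII X X' : ℝ) :
    betaRpDelta d mu PsiToXi muPiToXii XiAbs XiDeltaAbs X XiDeltageqTwoAbs XiIotaAbs XiIotaDeltaEiAbs XiIotaDeltaZeroAbs XiIotaDeltaEigeqOneAbs XiIotaDeltaZerogeqOneAbs XiIotaDeltaRI XiIotaDeltaRII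
      - betaRpDelta d mu PsiToXi muPiToXii XiAbs XiDeltaAbs X' XiDeltageqTwoAbs XiIotaAbs XiIotaDeltaEiAbs XiIotaDeltaZeroAbs XiIotaDeltaEigeqOneAbs XiIotaDeltaZerogeqOneAbs XiIotaDeltaRI XiIotaDeltaRII = X - X' := by
  simp only [betaRpDelta]; ring

/-- Sanity: the D31 correction touches only component 3 (`β_{ΔR,Φ}`, (D.21)); the other four extra `β`'s agree
definitionally. [folklore] -/
theorem extraOfInputsAsCoded_agrees (d : ℝ) (i : Inputs) :
    extraOfInputsAsCoded d i 0 = extraOfInputs d i 0 ∧ extraOfInputsAsCoded d i 1 = extraOfInputs d i 1 ∧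
    extraOfInputsAsCoded d i 2 = extraOfInputs d i 2 ∧ extraOfInputsAsCoded d i 4 = extraOfInputs d i 4 :=
  ⟨rfl, rfl, rfl, rfl⟩

/-- DIVERGENCE D31 in symbols: printed minus coded `β_{ΔR,Φ}` = `(β^{(0)}_{ΔΞ,R} + β^{(1)}_{ΔΞ,R}) − (β^{(0)}_{Ξ,R} + β^{(1)}_{Ξ,R})`
(at `d = 11`, `s = o`: 0.042344 − 0.011983, i.e. 0.060870 − 0.030509; CONSTANTS §H). [folklore] -/
theorem extraOfInputs_three_sub_asCoded (d : ℝ) (i : Inputs) :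
    extraOfInputs d i 3 - extraOfInputsAsCoded d i 3 = (i.xiR0Delta + i.xiR1Delta) - (i.xiR0 + i.xiR1) :=
  betaRpDelta_sub_of_xiDeltaR ..

end BetaMap
end Literature.Probability.FitznerVanDerHofstad2017

end
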